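import Summits.HodgeConjecture.CorCM.Census.TwistGenerationFaces
import Summits.HodgeConjecture.CorCM.Census.CoinvariantFloor

/-!
# Uniform twist generation, VIII: THE LAW — `β − 1` rank-four face relations generate the Hodge lattice of `(ℤ/2n × B, (n, 0))` modulo pairs,
# for EVERY `n ≥ 2` and EVERY finite group `B` with `|B| ≥ 3`

COR-CM (cell `pub-hodgecm2`), count-neutral kernel combinatorics by the binder seat b09 (gen 36; lane UNIFORM TWIST GENERATION, part VIII, the
assembly), on parts I–VII used BY NAME.  Theorems only: no definition, no `decide`, no certificate, no named fact, no `sorry`.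
HONEST FRAMING: `HC_CM` is NOT proved, here or anywhere in the tree; nothing here is a period or a headline.

**MAIN THEOREM** (`exists_gfaces_generate`).  Let `G` be a finite group with a datum `θ : G ≃ ℤ/2n × B` (`θ (PQ) = θ P + θ Q`, `θ c = (n, 0)`;
`n ≥ 2`, `B` any finite group written additively with `|B| ≥ 3`) — i.e. `G ≅ ℤ/2n × B` with `c` the involution of the cyclic factor; for `n = 2^j`
these are ALL the `2^{j+1}`-ic twists of the lane notes (the normal form of an abelian `(G, c)` with `c` of height `2^j`).  Then there is a finite set
`S ⊆ gfaceSet G c` of rank-four face relations with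

  `|S| + 1 ≤ β(G, c) = #Block c`   and   `hodgeSpan c ≤ ℤ⟨pairs⟩ + ℤ⟨all base changes of S⟩`,

so **`μ(G, c) ≤ β − 1`** uniformly in `n`.  With seat b09ʼs coinvariant floor (`Census/CoinvariantFloor.fibreTwo_le_card_of_faces`) and the twist
fibre law (`Census/CoinvariantTwistLaw`: `φ₂ + 1 + [∃ b ∈ B, 2^{j+1} ∣ ord b] = β`) this is the upper half of the lane noteʼs GRAND CONJECTURE at every
level: `μ = β − 1` EXACTLY whenever no element of `B` has order divisible by `2n = 2^{j+1}` (all odd `|B|`, …), and `β − 2 ≤ μ ≤ β − 1` otherwise —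
previously a kernel theorem only for `n = 1` (slices), `n = 2` (`Census/QuarticTwist*`, 17 files) and `n = 4` (`Census/OcticTwist*`, 28 files).

THE FAMILY (§3): one potential-lowering face per block of Hamming potential `≥ 2` to the `B`-constant arc types (part IV), plus `n` CLOSING FACES at the
profile type `prof Q` (`|Q| = ⌊(|B| − 1)/2⌋`, columns `b₁ ≠ b₂ ∉ Q`): the `n − 1` transfer faces `gface (prof Q) θ⁻¹(k, b₁) θ⁻¹(0, b₂)`, `1 ≤ k < n`,
and the equatorial square `gface (prof Q) θ⁻¹(0, b₁) θ⁻¹(0, b₂)`; the count (§2): the residual blocks — the constants and the `n` atom classes — are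
`n + 1` distinct blocks (`card_filter_add_le_card_block`).  §1: base changes of transfers and upper stars.

## References
* [Pohlmann1968] H. Pohlmann, Algebraic cycles on abelian varieties of complex multiplication type, Ann. of Math. 88 (1968), Thm 1.
* [Milne1999] J. S. Milne, Lefschetz motives and the Tate conjecture, Compositio Math. 117 (1999), Prop. 2.1, p. 54.
-/

namespace Summit.HodgeConjecture.CorCM.Census.TwistGeneration

open Finset
open Summit.HodgeConjecture.CorCM.Prior.AllgGroup.RfwfAllgGroup
open Summit.HodgeConjecture.CorCM.Census.BlockParity
open Summit.HodgeConjecture.CorCM.Census.Coinvariant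

noncomputable section

variable {G : Type*} [Group G] [Fintype G] [DecidableEq G] {c : G}
variable {B : Type} [AddGroup B] [DecidableEq B] [Fintype B]
variable {n : ℕ} [NeZero n] (θ : G ≃ ZMod (2 * n) × B)
variable (hθ : ∀ P Q : G, θ (P * Q) = θ P + θ Q) (hθc : θ c = (((n : ℕ) : ZMod (2 * n)), 0))

/-! ## §1 Base changes of transfers and upper stars -/

omit [Fintype G] [DecidableEq G] [DecidableEq B] [Fintype B] [NeZero n] in
include hθ in
/-- `θ⁻¹(x, b) · Q⁻¹ = θ⁻¹(x − (θQ).1, b − (θQ).2)`. [folklore] -/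
theorem symm_mul_inv (x : ZMod (2 * n)) (b : B) (Q : G) : θ.symm (x, b) * Q⁻¹ = θ.symm (x - (θ Q).1, b - (θ Q).2) :=
  θ.injective (by
    rw [hθ, map_inv_eq θ hθ, Equiv.apply_symm_apply, Equiv.apply_symm_apply]
    exact Prod.ext (sub_eq_add_neg _ _).symm (sub_eq_add_neg _ _).symm)

omit [DecidableEq B] [Fintype B] in
/-- **Base change of a transfer**: `(trans a x b)·Q⁻¹ = trans (a − (θQ).1) (x − (θQ).1) (b − (θQ).2)`. [folklore] -/
theorem mapDomain_rt_trans (hc2 : c * c = 1) (Q : G) (a x : ZMod (2 * n)) (b : B) :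
    Finsupp.mapDomain (rt c Q) (trans θ hθ hθc hc2 a x b) = trans θ hθ hθc hc2 (a - (θ Q).1) (x - (θ Q).1) (b - (θ Q).2) := by
  unfold trans
  simp only [Finsupp.mapDomain_add, Finsupp.mapDomain_sub, Finsupp.mapDomain_single, rt_oflipCM, rt_cst, symm_mul_inv θ hθ,
    add_sub_right_comm]

omit [DecidableEq B] in
/-- **Base change of an upper star**: `(wplus x)·Q⁻¹ = wplus (x − (θQ).1)`. [folklore] -/
theorem mapDomain_rt_wplus (hc2 : c * c = 1) (Q : G) (x : ZMod (2 * n)) :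
    Finsupp.mapDomain (rt c Q) (wplus θ hθ hθc hc2 x) = wplus θ hθ hθc hc2 (x - (θ Q).1) := by
  unfold wplus catom
  simp only [Finsupp.mapDomain_sub, Finsupp.mapDomain_finsetSum, Finsupp.mapDomain_smul, Finsupp.mapDomain_single, rt_oflipCM, rt_cst,
    symm_mul_inv θ hθ, add_sub_right_comm]
  congr 2
  exact Fintype.sum_equiv (Equiv.subRight (θ Q).2) _ _ fun b => rfl

/-! ## §2 The residual blocks are `n + 1` distinct blocks -/

omit [DecidableEq B] in
/-- **The count**: the blocks of potential `≥ 2` number at most `β − (n + 1)` (`|B| ≥ 3`). [folklore] -/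
theorem card_filter_add_le_card_block (hc2 : c * c = 1) (hB : 3 ≤ Fintype.card B) (b₀ : B) :
    (univ.filter fun Bk : Block c => 2 ≤ pot θ hθ hθc Bk.out).card + (n + 1) ≤ Fintype.card (Block c) := by
  classical
  have h2n : n < 2 * n := by have := NeZero.ne n; omega
  set f : ℕ → Block c := fun i => blk c (oflipCM c hc2 (θ.symm ((i : ℕ), b₀)) (cst θ hθ hθc 0)) with hf
  set RB : Finset (Block c) := insert (blk c (cst θ hθ hθc 0)) ((range n).image f) with hRB
  -- potentials are block invariants
  have hpot_out : ∀ Ψ : CMF G c, pot θ hθ hθc (blk c Ψ).out = pot θ hθ hθc Ψ := by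
    intro Ψ
    obtain ⟨Q, hQ⟩ := exists_rt_eq_of_blk_eq c (Quotient.out_eq (blk c Ψ) : blk c (blk c Ψ).out = blk c Ψ)
    rw [← pot_rt θ hθ hθc Q, hQ]
  have hmem0 : ∀ i : ℕ, i < n → θ.symm ((i : ℕ), b₀) ∈ (cst θ hθ hθc 0).1 := fun i hi =>
    symm_natCast_mem_cst_zero θ hθ hθc hi b₀
  -- `n + 1` distinct residual blocks
  have hinj : Set.InjOn f ↑(range n) := by
    intro i hi i' hi' h
    have hi := mem_range.mp (mem_coe.mp hi)
    have hi' := mem_range.mp (mem_coe.mp hi')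
    have h1 := eq_of_blk_oflipCM_eq θ hθ hθc hc2 hB (by rw [ZMod.val_cast_of_lt (by omega)]; exact hi)
      (by rw [ZMod.val_cast_of_lt (by omega)]; exact hi') h
    have h2 := congrArg ZMod.val h1
    rwa [ZMod.val_cast_of_lt (by omega), ZMod.val_cast_of_lt (by omega)] at h2
  have hnot : blk c (cst θ hθ hθc 0) ∉ (range n).image f := by
    intro h
    obtain ⟨i, hi, hfi⟩ := mem_image.mp h
    obtain ⟨Q, hQ⟩ := exists_rt_eq_of_blk_eq c hfi
    have h1 := pot_rt θ hθ hθc Q (oflipCM c hc2 (θ.symm ((i : ℕ), b₀)) (cst θ hθ hθc 0))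
    rw [hQ, pot_cst, pot_oflipCM_cst θ hθ hθc hc2 (by omega) (hmem0 i (mem_range.mp hi))] at h1
    exact one_ne_zero h1.symm
  have hcard : RB.card = n + 1 := by
    rw [hRB, card_insert_of_notMem hnot, card_image_of_injOn hinj, card_range]
  -- residual blocks have potential `≤ 1`
  have hres : ∀ Bk ∈ RB, pot θ hθ hθc Bk.out ≤ 1 := by
    intro Bk hBk
    rcases mem_insert.mp hBk with rfl | h
    · rw [hpot_out, pot_cst]; exact zero_le_one
    · obtain ⟨i, hi, rfl⟩ := mem_image.mp h
      change pot θ hθ hθc (blk c _).out ≤ 1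
      rw [hpot_out, pot_oflipCM_cst θ hθ hθc hc2 (by omega) (hmem0 i (mem_range.mp hi))]
  have hsub : (univ.filter fun Bk : Block c => 2 ≤ pot θ hθ hθc Bk.out) ⊆ univ \ RB := by
    intro Bk hBk
    rw [mem_sdiff]
    exact ⟨mem_univ _, fun h => by have := (mem_filter.mp hBk).2; have := hres Bk h; omega⟩
  have h := card_le_card hsub
  rw [card_sdiff_of_subset (subset_univ _), card_univ, hcard] at h
  have : n + 1 ≤ Fintype.card (Block c) := by rw [← hcard, ← card_univ]; exact card_le_univ _
  omega

/-! ## §3 The law -/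

omit [Fintype G] [DecidableEq B] [Fintype B] [NeZero n] in
include hθ hθc in
/-- Points of different columns lie in different places. [folklore] -/
theorem symm_not_mem_orb {b₁ b₂ : B} (h : b₁ ≠ b₂) (x y : ZMod (2 * n)) : θ.symm (y, b₂) ∉ orb c (θ.symm (x, b₁)) := by
  rw [mem_orb, c_mul_symm θ hθ hθc]
  rintro (h' | h')
  · exact h (congrArg Prod.snd (θ.symm.injective h')).symm
  · exact h (congrArg Prod.snd (θ.symm.injective h')).symm

include θ hθ hθc in
/-- **MAIN THEOREM — UNIFORM TWIST GENERATION.**  Along a datum `θ : G ≃ ℤ/2n × B` (`n ≥ 2`, `|B| ≥ 3`) there is a finite set `S` of rank-four face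
relations with `|S| + 1 ≤ β(G, c)` whose base changes generate the integer Hodge lattice modulo the pairs: `μ(G, c) ≤ β − 1`. [folklore] -/
theorem exists_gfaces_generate (hc2 : c * c = 1) (hn : 2 ≤ n) (hB : 3 ≤ Fintype.card B) :
    ∃ S : Finset (CMF G c →₀ ℤ), (↑S ⊆ gfaceSet G c hc2) ∧ S.card + 1 ≤ Fintype.card (Block c) ∧
      hodgeSpan c hc2 ≤ Submodule.span ℤ (pairSet c) ⊔ Submodule.span ℤ (translates c S) := by
  classical
  have hcen := mul_comm_c θ hθ hθc
  -- the profile data: `|Q| = ⌊(|B| − 1)/2⌋`, `b₁ ≠ b₂ ∉ Q`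
  obtain ⟨Q, -, hQ⟩ := Finset.exists_subset_card_eq (s := (univ : Finset B)) (n := (Fintype.card B - 1) / 2)
    (by rw [card_univ]; omega)
  have hQ1 : 2 * Q.card + 1 ≤ Fintype.card B := by rw [hQ]; omega
  have hQ2 : Fintype.card B ≤ 2 * Q.card + 2 := by rw [hQ]; omega
  have hcompl : 1 < (univ \ Q).card := by rw [card_sdiff_of_subset (subset_univ _), card_univ]; omega
  obtain ⟨b₁, hb₁, b₂, hb₂, h12⟩ := Finset.one_lt_card.mp hcompl
  have hb₁Q : b₁ ∉ Q := (mem_sdiff.mp hb₁).2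
  have hb₂Q : b₂ ∉ Q := (mem_sdiff.mp hb₂).2
  -- the family: covering faces, transfer faces, the equatorial square
  obtain ⟨S₀, hS₀, hcard₀, hcov⟩ := exists_cover θ hθ hθc hc2 hn
  set F : ℕ → (CMF G c →₀ ℤ) := fun k => gface c hc2 (prof θ hθ hθc Q) (θ.symm ((k : ℕ), b₁)) (θ.symm (0, b₂)) with hF
  set Feq : CMF G c →₀ ℤ := gface c hc2 (prof θ hθ hθc Q) (θ.symm (0, b₁)) (θ.symm (0, b₂)) with hFeq
  set S : Finset (CMF G c →₀ ℤ) := S₀ ∪ insert Feq ((Ico 1 n).image F) with hS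
  have hSsub : (↑S : Set (CMF G c →₀ ℤ)) ⊆ gfaceSet G c hc2 := by
    intro y hy
    rcases mem_union.mp (mem_coe.mp hy) with h | h
    · exact hS₀ h
    · rcases mem_insert.mp h with rfl | h
      · exact ⟨_, _, _, symm_not_mem_orb θ hθ hθc h12 0 0, rfl⟩
      · obtain ⟨k, -, rfl⟩ := mem_image.mp h
        exact ⟨_, _, _, symm_not_mem_orb θ hθ hθc h12 _ 0, rfl⟩
  refine ⟨S, hSsub, ?_, ?_⟩
  · -- the count
    have h1 : S.card ≤ S₀.card + (((Ico 1 n).image F).card + 1) :=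
      (card_union_le _ _).trans (by have := card_insert_le Feq ((Ico 1 n).image F); omega)
    have h2 : ((Ico 1 n).image F).card ≤ n - 1 := card_image_le.trans (by rw [Nat.card_Ico])
    have h3 := card_filter_add_le_card_block θ hθ hθc hc2 hB b₁
    omega
  · -- generation
    set L : Submodule ℤ (CMF G c →₀ ℤ) := Submodule.span ℤ (pairSet c) ⊔ Submodule.span ℤ (translates c S) with hL
    have hmemS : ∀ s ∈ S, s ∈ L := fun s hs => Submodule.mem_sup_right (mem_span_translates_of_mem c S hs)
    have hL₀ : Submodule.span ℤ (translates c S₀) ≤ L := by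
      refine le_sup_of_le_right (Submodule.span_mono ?_)
      rintro _ ⟨Q', s, hs, rfl⟩
      exact ⟨Q', s, mem_union_left _ hs, rfl⟩
    obtain ⟨hred, hstar⟩ := hcov L hL₀
    have hP : Submodule.span ℤ (pairSet c) ≤ L := le_sup_left
    have hLH : L ≤ hodgeSpan c hc2 := by
      refine sup_le (Submodule.span_le.mpr fun y hy => ?_) (Submodule.span_le.mpr fun y hy => ?_)
      · obtain ⟨Ψ, rfl⟩ := hy; exact pair_mem_hodgeSpan c hc2 Ψ
      · obtain ⟨Q', s, hs, rfl⟩ := hy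
        obtain ⟨Φ, t, t', ht', rfl⟩ := hSsub hs
        refine gfaceSet_subset_hodgeSpan c hc2 ?_
        rw [mapDomain_rt_gface]
        exact ⟨rt c Q' Φ, t * Q'⁻¹, t' * Q'⁻¹, notMem_orb_mul_inv c Q' ht', rfl⟩
    -- the transfers
    have hT0 : ∀ k : ℕ, 1 ≤ k → k < n → trans θ hθ hθc hc2 0 ((k : ℕ) : ZMod (2 * n)) b₁ ∈ L := by
      intro k hk1 hk
      refine trans_zero_mem θ hθ hθc hc2 hn hB Q hQ1 hQ2 hb₁Q hb₂Q h12 hk1 hk L hstar (hmemS _ ?_)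
      exact mem_union_right _ (mem_insert_of_mem (mem_image_of_mem F (mem_Ico.mpr ⟨hk1, hk⟩)))
    have hT : ∀ (a x : ZMod (2 * n)) (b : B), 1 ≤ (x - a).val → (x - a).val < n → trans θ hθ hθc hc2 a x b ∈ L := by
      intro a x b h1 h2
      have h := mapDomain_rt_mem_psp c hcen (θ.symm (-a, -b + b₁)) S (hT0 _ h1 h2)
      rw [mapDomain_rt_trans, Equiv.apply_symm_apply] at h
      have eb : b₁ - (-b + b₁) = b := by rw [sub_eq_add_neg, neg_add_rev, neg_neg, add_neg_cancel_left]
      simp only [sub_neg_eq_add, zero_add, ZMod.natCast_zmod_val, sub_add_cancel, eb] at h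
      exact h
    -- the upper stars
    have hW0 : wplus θ hθ hθc hc2 0 ∈ L :=
      wplus_zero_mem θ hθ hθc hc2 hn Q hQ1 hQ2 hb₁Q hb₂Q h12 L hP hstar hT (hmemS _ (mem_union_right _ (mem_insert_self _ _)))
    have hW : ∀ x : ZMod (2 * n), wplus θ hθ hθc hc2 x ∈ L := by
      intro x
      have h := mapDomain_rt_mem_psp c hcen (θ.symm (-x, 0)) S hW0
      rw [mapDomain_rt_wplus, Equiv.apply_symm_apply] at h
      simp only [zero_sub, neg_neg] at h
      exact h
    -- descent + residual elimination
    intro y hy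
    obtain ⟨y', hyy', hy'⟩ := hred y
    have hy'H : y' ∈ hodgeSpan c hc2 := by
      have e : y' = y - (y - y') := by abel
      rw [e]; exact Submodule.sub_mem _ hy (hLH hyy')
    have hres := residual_mem θ hθ hθc hc2 b₁ L hP hLH hT hW y' (exists_forall_typeSum_eq_of_mem_hodgeSpan c hc2 hcen hy'H) hy'
    have e : y = (y - y') + y' := by abel
    rw [e]
    exact Submodule.add_mem _ hyy' hres

include θ hθ hθc in
/-- **The face form**: the face relations themselves lie in `ℤ⟨pairs⟩ + ℤ⟨translates of S⟩` (the hypothesis shape of seat b09ʼs coinvariant floor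
`Census/CoinvariantFloor.fibreTwo_le_card_of_faces`). [folklore] -/
theorem exists_gfaceSet_subset (hc2 : c * c = 1) (hn : 2 ≤ n) (hB : 3 ≤ Fintype.card B) :
    ∃ S : Finset (CMF G c →₀ ℤ), (↑S ⊆ gfaceSet G c hc2) ∧ S.card + 1 ≤ Fintype.card (Block c) ∧
      gfaceSet G c hc2 ⊆ ↑(Submodule.span ℤ (pairSet c) ⊔ Submodule.span ℤ (translates c S)) := by
  obtain ⟨S, hS, hcard, hgen⟩ := exists_gfaces_generate θ hθ hθc hc2 hn hB
  exact ⟨S, hS, hcard, fun y hy => hgen (gfaceSet_subset_hodgeSpan c hc2 hy)⟩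

include θ hθ hθc in
/-- **The coinvariant reading**: `φ₂(G, c) ≤ |S| ≤ β − 1` for the family — the generating family sits between seat b09ʼs coinvariant floor and the block
count. [folklore] -/
theorem exists_gfaces_generate_fibreTwo (hc2 : c * c = 1) (hn : 2 ≤ n) (hB : 3 ≤ Fintype.card B) :
    ∃ S : Finset (CMF G c →₀ ℤ), (↑S ⊆ gfaceSet G c hc2) ∧ fibreTwo c hc2 ≤ S.card ∧ S.card + 1 ≤ Fintype.card (Block c) ∧
      hodgeSpan c hc2 ≤ Submodule.span ℤ (pairSet c) ⊔ Submodule.span ℤ (translates c S) := by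
  obtain ⟨S, hS, hcard, hgen⟩ := exists_gfaces_generate θ hθ hθc hc2 hn hB
  exact ⟨S, hS, fibreTwo_le_card_of_faces c hc2 (mul_comm_c θ hθ hθc) S hS (fun y hy => hgen (gfaceSet_subset_hodgeSpan c hc2 hy)),
    hcard, hgen⟩

end

end Summit.HodgeConjecture.CorCM.Census.TwistGeneration
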